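import Literature.Geometry.Kaehler.ChartWindow
import Literature.Topology.FourManifolds.CollarUniquenessBall

/-!
# An absolute bound for the derivative of the collapse map of a chart window

For a chart window `W` (`ChartWindow.lean`) whose chart has `‖DΨ‖ ≤ M` on `ball 0 ρ` and whose
vertical width is small compared to the lateral cutoff scale, `τ ≤ (a₁² − a₂²)/(2ρ)`, the collapse
map `h = id − λ κ w` satisfies **`‖Dh(x)‖ ≤ L₀(M)` for all `x`**, with
`L₀(M) = 2 + M + C_σ (1 + (8/3)(1 + M))` depending only on `M` and the tree's absolute bound
`C_σ` of the derivative of `Real.smoothTransition`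
(`Literature.Topology.FourManifolds.smoothTransitionDerivBound`)
(`ChartWindow.norm_fderiv_collapse_le`). Hence `h` is Lipschitz with a constant independent of the
window once `M ≤ 2` (almost isometric charts, `OrthoChart.exists_radius`): the uniform Lipschitz
control needed to sum the error terms of the retraction in King's tangent cone theorem.

The proof is the product rule: `D(λκw) = Dλ ⊗ κw + λ(Dκ ⊗ w + κ Dw)` with
`‖Dλ‖ ≤ 2C_σ ρ/(a₁² − a₂²)`, `‖κ w‖ ≤ τ`, `‖Dκ‖ ‖w‖ ≤ (8/3) C_σ (1+M) ‖w‖²/τ² ≤ (8/3)C_σ(1+M)` where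
`‖w‖ ≤ τ` (and `D(λκw) = 0` where `‖w‖ > τ` or off the chart domain), `‖Dw‖ ≤ 1 + M`.

Definition with body (`collapseLipConst`) + theorems; no named facts.

## References

* H. Federer, *Geometric Measure Theory*, Springer 1969, 4.1.9, 4.3.18 [Federer1969].
-/

noncomputable section

open scoped Topology ContDiff InnerProductSpace
open Set Filter Metric Function Module TopologicalSpace Real

namespace Literature.Geometry.Kaehler

/-! ### The derivative of `Real.smoothTransition` is bounded

We use the tree's absolute constant `Literature.Topology.FourManifolds.smoothTransitionDerivBound`
(`C_σ > 0` with `‖σ'(t)‖ ≤ C_σ`, `norm_deriv_smoothTransition_le`). -/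

open Literature.Topology.FourManifolds (smoothTransitionDerivBound norm_deriv_smoothTransition_le
  smoothTransitionDerivBound_pos)

/-- **Chain rule bound**: `‖D(σ ∘ g)(x)‖ ≤ C_σ ‖Dg(x)‖`. [folklore] -/
theorem hasFDerivAt_smoothTransition_comp {E : Type*} [NormedAddCommGroup E] [NormedSpace ℝ E]
    {g : E → ℝ} {g' : E →L[ℝ] ℝ} {x : E} (hg : HasFDerivAt g g' x) :
    HasFDerivAt (fun y => smoothTransition (g y)) (deriv smoothTransition (g x) • g') x :=
  ((smoothTransition.contDiff (n := 1)).differentiable one_ne_zero _).hasDerivAt.comp_hasFDerivAt x hg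

/-- `‖σ'(t) • g'‖ ≤ C_σ ‖g'‖`. [folklore] -/
theorem norm_deriv_smoothTransition_smul_le {E : Type*} [NormedAddCommGroup E] [NormedSpace ℝ E]
    (t : ℝ) (g' : E →L[ℝ] ℝ) : ‖deriv smoothTransition t • g'‖ ≤ smoothTransitionDerivBound * ‖g'‖ := by
  rw [norm_smul]
  exact mul_le_mul_of_nonneg_right (norm_deriv_smoothTransition_le t) (norm_nonneg _)

/-! ### The bound -/

universe u

variable {V : Type u} [NormedAddCommGroup V] [InnerProductSpace ℂ V] [FiniteDimensional ℂ V]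

/-- **The absolute Lipschitz constant `L₀(M)`** of the collapse maps of chart windows with
`‖DΨ‖ ≤ M`. [folklore] -/
def collapseLipConst (M : ℝ) : ℝ := 2 + M + smoothTransitionDerivBound * (1 + 8 / 3 * (1 + M))

namespace ChartWindow

variable (W : ChartWindow V)

/-- `D k = P_K` (real-linear). [folklore] -/
theorem hasFDerivAt_kf (x : V) :
    HasFDerivAt W.kf (W.K.orthogonalProjectionOnto.restrictScalars ℝ) x := by
  have h := ((W.K.orthogonalProjectionOnto.restrictScalars ℝ).hasFDerivAt (x := x - W.m)).comp x
    ((hasFDerivAt_id x).sub_const W.m)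
  rw [ContinuousLinearMap.comp_id] at h
  exact h

/-- `‖D k‖ ≤ 1`. [folklore] -/
theorem norm_fderiv_kf_le : ‖(W.K.orthogonalProjectionOnto.restrictScalars ℝ : V →L[ℝ] W.K)‖ ≤ 1 := by
  rw [ContinuousLinearMap.norm_restrictScalars]
  exact W.K.orthogonalProjectionOnto_norm_le

/-- **`D w = I − DΨ(k x) ∘ P_K`** on the chart domain, with `‖D w‖ ≤ 1 + M` when `‖DΨ‖ ≤ M`.
[folklore] -/
theorem hasFDerivAt_wf {x : V} (hx : ‖W.kf x‖ < W.ρ) :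
    HasFDerivAt W.wf (ContinuousLinearMap.id ℝ V -
      ((fderiv ℂ W.Ψ (W.kf x)).restrictScalars ℝ).comp (W.K.orthogonalProjectionOnto.restrictScalars ℝ)) x := by
  have hΨ : DifferentiableAt ℂ W.Ψ (W.kf x) :=
    (W.differentiableOn _ (mem_ball_zero_iff.2 hx)).differentiableAt
      (isOpen_ball.mem_nhds (mem_ball_zero_iff.2 hx))
  have h1 : HasFDerivAt W.Ψ ((fderiv ℂ W.Ψ (W.kf x)).restrictScalars ℝ) (W.kf x) :=
    hΨ.hasFDerivAt.restrictScalars ℝ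
  exact (hasFDerivAt_id x).sub (h1.comp x (W.hasFDerivAt_kf x))

/-- `‖D w‖ ≤ 1 + M` when `‖DΨ‖ ≤ M`. [folklore] -/
theorem norm_fderiv_wf_le {x : V} (hx : ‖W.kf x‖ < W.ρ) {M : ℝ}
    (hM : ∀ k ∈ ball (0 : W.K) W.ρ, ‖fderiv ℂ W.Ψ k‖ ≤ M) :
    ‖(ContinuousLinearMap.id ℝ V -
      ((fderiv ℂ W.Ψ (W.kf x)).restrictScalars ℝ).comp (W.K.orthogonalProjectionOnto.restrictScalars ℝ))‖ ≤
      1 + M := by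
  refine (norm_sub_le _ _).trans (add_le_add ContinuousLinearMap.norm_id_le ?_)
  refine (ContinuousLinearMap.opNorm_comp_le _ _).trans ?_
  rw [ContinuousLinearMap.norm_restrictScalars]
  have hMx : ‖fderiv ℂ W.Ψ (W.kf x)‖ ≤ M := hM _ (mem_ball_zero_iff.2 hx)
  have hM0 : 0 ≤ M := (norm_nonneg (fderiv ℂ W.Ψ (W.kf x))).trans hMx
  have hP0 : 0 ≤ ‖(W.K.orthogonalProjectionOnto.restrictScalars ℝ : V →L[ℝ] W.K)‖ :=
    ContinuousLinearMap.opNorm_nonneg _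
  calc ‖fderiv ℂ W.Ψ (W.kf x)‖ * ‖(W.K.orthogonalProjectionOnto.restrictScalars ℝ : V →L[ℝ] W.K)‖
      ≤ M * 1 := mul_le_mul hMx W.norm_fderiv_kf_le hP0 hM0
    _ = M := mul_one M

/-- **`‖Dλ(x)‖ ≤ 2 C_σ ρ / (a₁² − a₂²)`** on the chart domain. [folklore] -/
theorem exists_hasFDerivAt_lam {x : V} (hx : ‖W.kf x‖ < W.ρ) :
    ∃ L : V →L[ℝ] ℝ, HasFDerivAt W.lam L x ∧
      ‖L‖ ≤ smoothTransitionDerivBound * (2 * W.ρ / (W.a₁ ^ 2 - W.a₂ ^ 2)) := by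
  letI : InnerProductSpace ℝ W.K := InnerProductSpace.complexToReal
  have hc : 0 < W.a₁ ^ 2 - W.a₂ ^ 2 := by nlinarith [W.a₂_lt, W.a₂_pos]
  -- `g(y) = (a₁² - ‖k y‖²)/(a₁² - a₂²)`
  have hk := W.hasFDerivAt_kf x
  have hsq := hk.norm_sq
  set P' : V →L[ℝ] W.K := W.K.orthogonalProjectionOnto.restrictScalars ℝ with hP'
  set A : V →L[ℝ] ℝ := (innerSL ℝ (W.kf x)).comp P' with hA
  have hP0 : 0 ≤ ‖P'‖ := ContinuousLinearMap.opNorm_nonneg _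
  have hAn : ‖A‖ ≤ W.ρ := by
    refine (ContinuousLinearMap.opNorm_comp_le _ _).trans ?_
    rw [innerSL_apply_norm]
    calc ‖W.kf x‖ * ‖P'‖ ≤ W.ρ * 1 := mul_le_mul hx.le W.norm_fderiv_kf_le hP0 W.ρ_pos.le
      _ = W.ρ := mul_one _
  set c : ℝ := W.a₁ ^ 2 - W.a₂ ^ 2 with hcdef
  have hg : HasFDerivAt (fun y => (W.a₁ ^ 2 - ‖W.kf y‖ ^ 2) * c⁻¹)
      (c⁻¹ • ((0 : V →L[ℝ] ℝ) - (2 : ℕ) • A)) x :=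
    ((hasFDerivAt_const (W.a₁ ^ 2) x).sub hsq).mul_const c⁻¹
  have hfun : W.lam = fun y => smoothTransition ((W.a₁ ^ 2 - ‖W.kf y‖ ^ 2) * c⁻¹) := by
    funext y; simp [ChartWindow.lam, hcdef, div_eq_mul_inv]
  refine ⟨_, hfun ▸ hasFDerivAt_smoothTransition_comp hg,
    (norm_deriv_smoothTransition_smul_le _ _).trans ?_⟩
  refine mul_le_mul_of_nonneg_left ?_ smoothTransitionDerivBound_pos.le
  rw [norm_smul, norm_inv, Real.norm_of_nonneg hc.le, zero_sub, norm_neg, div_eq_mul_inv, mul_comm]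
  refine mul_le_mul_of_nonneg_right ?_ (inv_nonneg.2 hc.le)
  calc ‖(2 : ℕ) • A‖ = ‖A + A‖ := by rw [two_nsmul]
    _ ≤ ‖A‖ + ‖A‖ := norm_add_le _ _
    _ ≤ W.ρ + W.ρ := add_le_add hAn hAn
    _ = 2 * W.ρ := by ring

/-- **`‖Dκ(x)‖ ≤ (8/3) C_σ (1+M) ‖w x‖ / τ²`** on the chart domain. [folklore] -/
theorem exists_hasFDerivAt_kap {x : V} (hx : ‖W.kf x‖ < W.ρ) {M : ℝ}
    (hM : ∀ k ∈ ball (0 : W.K) W.ρ, ‖fderiv ℂ W.Ψ k‖ ≤ M) :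
    ∃ L : V →L[ℝ] ℝ, HasFDerivAt W.kap L x ∧
      ‖L‖ ≤ smoothTransitionDerivBound * (8 / (3 * W.τ ^ 2) * ((1 + M) * ‖W.wf x‖)) := by
  letI : InnerProductSpace ℝ V := InnerProductSpace.complexToReal
  have hτ2 : 0 < 3 * W.τ ^ 2 / 4 := by nlinarith [W.τ_pos]
  have hw := W.hasFDerivAt_wf hx
  set Dw := ContinuousLinearMap.id ℝ V -
    ((fderiv ℂ W.Ψ (W.kf x)).restrictScalars ℝ).comp (W.K.orthogonalProjectionOnto.restrictScalars ℝ)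
    with hDw
  have hsq := hw.norm_sq
  set A : V →L[ℝ] ℝ := (innerSL ℝ (W.wf x)).comp Dw with hA
  have hM0 : 0 ≤ 1 + M := (norm_nonneg _).trans (W.norm_fderiv_wf_le hx hM)
  have hAn : ‖A‖ ≤ ‖W.wf x‖ * (1 + M) := by
    refine (ContinuousLinearMap.opNorm_comp_le _ _).trans ?_
    rw [innerSL_apply_norm]
    exact mul_le_mul_of_nonneg_left (W.norm_fderiv_wf_le hx hM) (norm_nonneg _)
  set c : ℝ := 3 * W.τ ^ 2 / 4 with hcdef
  have hq : HasFDerivAt (fun y => (W.τ ^ 2 - ‖W.wf y‖ ^ 2) * c⁻¹)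
      (c⁻¹ • ((0 : V →L[ℝ] ℝ) - (2 : ℕ) • A)) x :=
    ((hasFDerivAt_const (W.τ ^ 2) x).sub hsq).mul_const c⁻¹
  have hfun : W.kap = fun y => smoothTransition ((W.τ ^ 2 - ‖W.wf y‖ ^ 2) * c⁻¹) := by
    funext y; simp [ChartWindow.kap, hcdef, div_eq_mul_inv]
  refine ⟨_, hfun ▸ hasFDerivAt_smoothTransition_comp hq,
    (norm_deriv_smoothTransition_smul_le _ _).trans ?_⟩
  refine mul_le_mul_of_nonneg_left ?_ smoothTransitionDerivBound_pos.le
  rw [norm_smul, norm_inv, Real.norm_of_nonneg hτ2.le, zero_sub, norm_neg]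
  have h8 : c⁻¹ = 8 / (3 * W.τ ^ 2) / 2 := by
    rw [hcdef]; field_simp; ring
  rw [h8]
  have h2A : ‖(2 : ℕ) • A‖ ≤ 2 * (‖W.wf x‖ * (1 + M)) := by
    calc ‖(2 : ℕ) • A‖ = ‖A + A‖ := by rw [two_nsmul]
      _ ≤ ‖A‖ + ‖A‖ := norm_add_le _ _
      _ ≤ 2 * (‖W.wf x‖ * (1 + M)) := by linarith
  calc 8 / (3 * W.τ ^ 2) / 2 * ‖(2 : ℕ) • A‖
      ≤ 8 / (3 * W.τ ^ 2) / 2 * (2 * (‖W.wf x‖ * (1 + M))) :=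
        mul_le_mul_of_nonneg_left h2A (by positivity)
    _ = 8 / (3 * W.τ ^ 2) * ((1 + M) * ‖W.wf x‖) := by ring

/-- Off the chart domain the displacement vanishes identically near the point. [folklore] -/
theorem disp_eventuallyEq_zero_of_le {x : V} (hx : W.a₁ < ‖W.kf x‖) : W.disp =ᶠ[𝓝 x] fun _ => 0 := by
  have hopen : IsOpen {y : V | W.a₁ < ‖W.kf y‖} :=
    isOpen_lt continuous_const (continuous_norm.comp W.contDiff_kf.continuous)
  filter_upwards [hopen.mem_nhds hx] with y hy
  simp [disp, W.lam_eq_zero hy.le]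

/-- Where `‖w‖ > τ` (inside the chart domain) the displacement vanishes near the point. [folklore] -/
theorem disp_eventuallyEq_zero_of_lt_wf {x : V} (hx : ‖W.kf x‖ < W.ρ) (hw : W.τ < ‖W.wf x‖) :
    W.disp =ᶠ[𝓝 x] fun _ => 0 := by
  have hcont : ContinuousAt (fun y => ‖W.wf y‖) x :=
    (continuous_norm.continuousAt).comp
      ((W.contDiffOn_wf.continuousOn.continuousAt (W.isOpen_chartDomain.mem_nhds hx)))
  have : ∀ᶠ y in 𝓝 x, W.τ < ‖W.wf y‖ := hcont.eventually (lt_mem_nhds hw)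
  filter_upwards [this] with y hy
  simp [disp, W.kap_eq_zero hy.le]

/-- **The derivative of the collapse map is bounded by the absolute constant `L₀(M)`** when
`‖DΨ‖ ≤ M` on the chart ball (`M ≥ 0`) and `τ ≤ (a₁² − a₂²)/(2ρ)`. [cite: Federer1969, 4.1.9, 4.3.18] -/
theorem norm_fderiv_collapse_le {M : ℝ} (hM0 : 0 ≤ M)
    (hM : ∀ k ∈ ball (0 : W.K) W.ρ, ‖fderiv ℂ W.Ψ k‖ ≤ M)
    (hτ : W.τ ≤ (W.a₁ ^ 2 - W.a₂ ^ 2) / (2 * W.ρ)) (x : V) :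
    ‖fderiv ℝ W.collapse x‖ ≤ collapseLipConst M := by
  have hCσ := smoothTransitionDerivBound_pos.le
  have hL1 : (1 : ℝ) ≤ collapseLipConst M := by
    unfold collapseLipConst; nlinarith
  -- `h = id - disp`
  have hid : ∀ {D : V →L[ℝ] V}, HasFDerivAt W.disp D x →
      ‖fderiv ℝ W.collapse x‖ ≤ 1 + ‖D‖ := fun {D} hD => by
    have := ((hasFDerivAt_id x).sub hD).fderiv
    rw [show (id - W.disp) = W.collapse from rfl] at this
    rw [this]
    exact (norm_sub_le _ _).trans (add_le_add ContinuousLinearMap.norm_id_le le_rfl)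
  -- the locally-zero cases
  have hzero : W.disp =ᶠ[𝓝 x] (fun _ => (0 : V)) → ‖fderiv ℝ W.collapse x‖ ≤ collapseLipConst M := by
    intro h0
    have hD : HasFDerivAt W.disp (0 : V →L[ℝ] V) x :=
      (hasFDerivAt_const (0 : V) x).congr_of_eventuallyEq h0
    exact (hid hD).trans (by rw [norm_zero, add_zero]; exact hL1)
  by_cases hx : W.a₁ < ‖W.kf x‖
  · exact hzero (W.disp_eventuallyEq_zero_of_le hx)
  have hxρ : ‖W.kf x‖ < W.ρ := (not_lt.1 hx).trans_lt W.a₁_lt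
  by_cases hw : W.τ < ‖W.wf x‖
  · exact hzero (W.disp_eventuallyEq_zero_of_lt_wf hxρ hw)
  have hwτ : ‖W.wf x‖ ≤ W.τ := not_lt.1 hw
  -- the product rule
  obtain ⟨Ll, hl, hln⟩ := W.exists_hasFDerivAt_lam hxρ
  obtain ⟨Lk, hk, hkn⟩ := W.exists_hasFDerivAt_kap hxρ hM
  have hwd := W.hasFDerivAt_wf hxρ
  set Dw := ContinuousLinearMap.id ℝ V -
    ((fderiv ℂ W.Ψ (W.kf x)).restrictScalars ℝ).comp (W.K.orthogonalProjectionOnto.restrictScalars ℝ)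
    with hDw
  have hinner : HasFDerivAt (fun y => W.kap y • W.wf y) (W.kap x • Dw + Lk.smulRight (W.wf x)) x :=
    hk.smul hwd
  have hdisp : HasFDerivAt W.disp
      (W.lam x • (W.kap x • Dw + Lk.smulRight (W.wf x)) + Ll.smulRight (W.kap x • W.wf x)) x :=
    hl.smul hinner
  refine (hid hdisp).trans ?_
  -- bounds of the three terms
  have hDwn : ‖Dw‖ ≤ 1 + M := W.norm_fderiv_wf_le hxρ hM
  have hc : 0 < W.a₁ ^ 2 - W.a₂ ^ 2 := by nlinarith [W.a₂_lt, W.a₂_pos]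
  have h1 : ‖Ll.smulRight (W.kap x • W.wf x)‖ ≤ smoothTransitionDerivBound := by
    rw [ContinuousLinearMap.norm_smulRight_apply, norm_smul, Real.norm_eq_abs,
      abs_of_nonneg (W.kap_nonneg x)]
    have hkw : W.kap x * ‖W.wf x‖ ≤ W.τ := by
      calc W.kap x * ‖W.wf x‖ ≤ 1 * W.τ :=
            mul_le_mul (W.kap_le_one x) hwτ (norm_nonneg _) zero_le_one
        _ = W.τ := one_mul _
    have hcoef : 0 ≤ smoothTransitionDerivBound * (2 * W.ρ / (W.a₁ ^ 2 - W.a₂ ^ 2)) :=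
      mul_nonneg hCσ (div_nonneg (by linarith [W.ρ_pos]) hc.le)
    calc ‖Ll‖ * (W.kap x * ‖W.wf x‖)
        ≤ smoothTransitionDerivBound * (2 * W.ρ / (W.a₁ ^ 2 - W.a₂ ^ 2)) * W.τ :=
          mul_le_mul hln hkw (mul_nonneg (W.kap_nonneg x) (norm_nonneg _)) hcoef
      _ ≤ smoothTransitionDerivBound * (2 * W.ρ / (W.a₁ ^ 2 - W.a₂ ^ 2)) *
            ((W.a₁ ^ 2 - W.a₂ ^ 2) / (2 * W.ρ)) := mul_le_mul_of_nonneg_left hτ hcoef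
      _ = smoothTransitionDerivBound := by
          have hρ := W.ρ_pos
          field_simp
  have h2 : ‖Lk.smulRight (W.wf x)‖ ≤ smoothTransitionDerivBound * (8 / 3 * (1 + M)) := by
    rw [ContinuousLinearMap.norm_smulRight_apply]
    have hsq : ‖W.wf x‖ ^ 2 ≤ W.τ ^ 2 := pow_le_pow_left₀ (norm_nonneg _) hwτ 2
    have hτ0 := W.τ_pos
    calc ‖Lk‖ * ‖W.wf x‖
        ≤ smoothTransitionDerivBound * (8 / (3 * W.τ ^ 2) * ((1 + M) * ‖W.wf x‖)) * ‖W.wf x‖ :=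
          mul_le_mul_of_nonneg_right hkn (norm_nonneg _)
      _ = smoothTransitionDerivBound * (8 / 3 * (1 + M)) * (‖W.wf x‖ ^ 2 / W.τ ^ 2) := by
          field_simp
      _ ≤ smoothTransitionDerivBound * (8 / 3 * (1 + M)) * 1 := by
          refine mul_le_mul_of_nonneg_left ?_ (mul_nonneg hCσ (by positivity))
          rw [div_le_one (by positivity)]
          exact hsq
      _ = smoothTransitionDerivBound * (8 / 3 * (1 + M)) := mul_one _
  have h3 : ‖W.kap x • Dw‖ ≤ 1 + M := by
    rw [norm_smul, Real.norm_eq_abs, abs_of_nonneg (W.kap_nonneg x)]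
    calc W.kap x * ‖Dw‖ ≤ 1 * (1 + M) :=
          mul_le_mul (W.kap_le_one x) hDwn (norm_nonneg _) zero_le_one
      _ = 1 + M := one_mul _
  have h4 : ‖W.lam x • (W.kap x • Dw + Lk.smulRight (W.wf x))‖ ≤
      (1 + M) + smoothTransitionDerivBound * (8 / 3 * (1 + M)) := by
    rw [norm_smul, Real.norm_eq_abs, abs_of_nonneg (W.lam_nonneg x)]
    calc W.lam x * ‖W.kap x • Dw + Lk.smulRight (W.wf x)‖
        ≤ 1 * ((1 + M) + smoothTransitionDerivBound * (8 / 3 * (1 + M))) :=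
          mul_le_mul (W.lam_le_one x) ((norm_add_le _ _).trans (add_le_add h3 h2)) (norm_nonneg _)
            zero_le_one
      _ = (1 + M) + smoothTransitionDerivBound * (8 / 3 * (1 + M)) := one_mul _
  calc 1 + ‖W.lam x • (W.kap x • Dw + Lk.smulRight (W.wf x)) + Ll.smulRight (W.kap x • W.wf x)‖
      ≤ 1 + (((1 + M) + smoothTransitionDerivBound * (8 / 3 * (1 + M))) +
          smoothTransitionDerivBound) := by
        gcongr
        exact (norm_add_le _ _).trans (add_le_add h4 h1)
    _ = collapseLipConst M := by unfold collapseLipConst; ring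

/-- **The collapse map is Lipschitz with the absolute constant `L₀(M)`.** [cite: Federer1969, 4.1.9] -/
theorem lipschitzWith_collapse {M : ℝ} (hM0 : 0 ≤ M)
    (hM : ∀ k ∈ ball (0 : W.K) W.ρ, ‖fderiv ℂ W.Ψ k‖ ≤ M)
    (hτ : W.τ ≤ (W.a₁ ^ 2 - W.a₂ ^ 2) / (2 * W.ρ)) :
    LipschitzWith (Real.toNNReal (collapseLipConst M)) W.collapse := by
  refine lipschitzWith_of_nnnorm_fderiv_le
    ((W.contDiff_collapse.differentiable (by simp))) fun x => ?_
  rw [← NNReal.coe_le_coe, coe_nnnorm, Real.coe_toNNReal _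
    (le_trans (norm_nonneg _) (W.norm_fderiv_collapse_le hM0 hM hτ x))]
  exact W.norm_fderiv_collapse_le hM0 hM hτ x

end ChartWindow

end Literature.Geometry.Kaehler
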